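import Mathlib
import Literature.Analysis.FluidPDE.ClassicalSolution
import Literature.Analysis.FluidPDE.LerayHopf
import Literature.Analysis.FluidPDE.ConstantinDirectionDissipationProofs
import Summits.NavierStokesRegularity.NavierStokesRegularity.Theorems.PlaneEnergyCeilingPlanarEnergyAPrioriFluxLedger

/-!
# Route PlaneEnergyCeiling · crux `PlanarEnergyAPriori` — the energy class in real-integral form

Helper file for the crux item stmt-NavierStokesRegularity-16855 (`PlanarEnergyAPriori`, route
`PlaneEnergyCeiling`), landed `--supports` that item. The signed flux ledger
(`Theorems/PlaneEnergyCeilingPlanarEnergyAPrioriFluxLedger.lean`) consumes the energy class in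
REAL (Bochner) form — `∫ |u(s)|² ≤ 2E₀` at every time and `ν ∫₀ᵗ∫ Σⱼ‖∂ⱼu‖² ≤ E₀`; this file
derives exactly these two inequalities, with `E₀ = kineticEnergy (u 0) = ½‖u(0)‖₂²`, from the
hypotheses of the crux (a classical solution on `[0,T)` that is Leray–Hopf from `u 0`):

* `integral_norm_sq_le_of_isLerayHopfOn` — `∫ ‖u(s)‖² ≤ 2E₀` for `s ∈ [0,T]` (energy
  inequality from `s = 0`, zero force, `ν ≥ 0`);
* `sum_norm_sq_apply_single_eq_frobeniusNormSq` — `Σⱼ ‖L eⱼ‖² = |L|²_F` on `ℝ³`;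
* `integral_Ioo_integral_sum_norm_sq_fderiv_le` — `ν ∫_{(0,t)}∫ Σⱼ‖∂ⱼu(s)‖² ≤ E₀` for `t ≤ T`
  (the weak gradient of the Leray–Hopf field is the classical one,
  `IsLerayHopfOn.lintegral_frobeniusNormSq_fderiv_of_classical`; passage from the `lintegral`
  to the Bochner form, which is `0` by convention if the iterated integrand is not integrable);
* `fluxLedger_alongLH_of_weightedEnergyIdentity` — consequently, along every solution of the
  crux's class (classical on `[0,T)`, Leray–Hopf from `u 0`) carrying order-(3,2) decay on a closed
  slab `[0,t]`, `t < T` (the output of `stub_decayPersistence`), the flux ledger holds with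
  `E₀ = kineticEnergy (u 0)`: `|∫_{(s₁,s₂)}∫ g'(x₂)(|u|²/2 + (p − π₀))u₂| ≤ E₀(2 + νK₂(s₂ − s₁))`,
  given the weighted energy identity (registered helper `weightedEnergyIdentity` of the line).

Folklore (Leray 1934 energy inequality); Mathlib + the accepted Constantin dissipation lemma.
-/

noncomputable section

-- single-conjunct summit: `Summit.<Summit>.<Problem>` repeats the name by the D-0017 layout
set_option linter.dupNamespace false

namespace Summit.NavierStokesRegularity.NavierStokesRegularity.Theorems.PlanarEnergyAPriori

open MeasureTheory Set Filter Topology Function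
open scoped ENNReal RealInnerProductSpace
open Literature.Analysis.FluidPDE

variable {ν T : ℝ} {u : ℝ → EuclideanSpace ℝ (Fin 3) → EuclideanSpace ℝ (Fin 3)} {p : ℝ → EuclideanSpace ℝ (Fin 3) → ℝ}

/-- `∫ ‖v‖² = 2 · kineticEnergy v` (definitional bookkeeping, no integrability needed). -/
theorem integral_norm_sq_eq_two_mul_kineticEnergy (v : EuclideanSpace ℝ (Fin 3) → EuclideanSpace ℝ (Fin 3)) :
    ∫ x, ‖v x‖ ^ 2 = 2 * VectorCalculus.kineticEnergy v := by
  rw [VectorCalculus.kineticEnergy]; ring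

/-- **Energy bound in real form.** Along a Leray–Hopf field with zero force and `ν ≥ 0`:
`∫ ‖u(s)‖² ≤ 2 · kineticEnergy (u 0)` for every `s ∈ [0,T]`. -/
theorem integral_norm_sq_le_of_isLerayHopfOn (hlh : IsLerayHopfOn T ν 0 (u 0) u) (hν : 0 ≤ ν) {s : ℝ}
    (hs : s ∈ Icc 0 T) : ∫ x, ‖u s x‖ ^ 2 ≤ 2 * VectorCalculus.kineticEnergy (u 0) := by
  obtain ⟨G, -, hE⟩ := hlh.energy_ineq_zero
  have h := hE s hs
  simp only [Pi.zero_apply, inner_zero_left, integral_zero, intervalIntegral.integral_zero,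
    add_zero] at h
  have hD : 0 ≤ ν * (∫⁻ τ in Ioo 0 s, ∫⁻ x, ENNReal.ofReal (frobeniusNormSq (G τ x))).toReal :=
    mul_nonneg hν ENNReal.toReal_nonneg
  rw [integral_norm_sq_eq_two_mul_kineticEnergy]
  linarith

/-- On `ℝ³`, `Σⱼ ‖L eⱼ‖² = |L|²_F` (the Frobenius norm over the standard basis). -/
theorem sum_norm_sq_apply_single_eq_frobeniusNormSq {F' : Type*} [NormedAddCommGroup F'] [InnerProductSpace ℝ F']
    [FiniteDimensional ℝ F'] (L : EuclideanSpace ℝ (Fin 3) →L[ℝ] F') :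
    ∑ j : Fin 3, ‖L (EuclideanSpace.single j 1)‖ ^ 2 = frobeniusNormSq L := by
  rw [frobeniusNormSq_eq_sum (EuclideanSpace.basisFun (Fin 3) ℝ)]
  simp

/-- **Dissipation bound in real form.** Along a classical solution of unforced Navier–Stokes on
`[0,T)` (`T > 0`, `ν > 0`) that is Leray–Hopf from `u 0`: for every `t ≤ T`,
`ν ∫_{(0,t)} ∫ Σⱼ ‖∂ⱼu(s)‖² dx ds ≤ kineticEnergy (u 0)` (Bochner form; the left side is `0` by
convention if the iterated integrand fails to be integrable in time, so the bound is unconditional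
on measurability). -/
theorem integral_Ioo_integral_sum_norm_sq_fderiv_le (hns : IsClassicalNSSolutionOn (Ico 0 T) ν 0 u p)
    (hlh : IsLerayHopfOn T ν 0 (u 0) u) (hν : 0 < ν) (hT : 0 < T) {t : ℝ} (ht : t ≤ T) :
    ν * ∫ s in Ioo 0 t, ∫ x, ∑ j : Fin 3, ‖fderiv ℝ (u s) x (EuclideanSpace.single j 1)‖ ^ 2 ≤
      VectorCalculus.kineticEnergy (u 0) := by
  obtain ⟨hfin, hdiss⟩ := IsLerayHopfOn.lintegral_frobeniusNormSq_fderiv_of_classical hns hlh hT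
  set D : ℝ≥0∞ := ∫⁻ τ in Ioo 0 T, ∫⁻ x, ENNReal.ofReal (frobeniusNormSq (fderiv ℝ (u τ) x)) with hD
  have hK0 : 0 ≤ VectorCalculus.kineticEnergy (u 0) := kineticEnergy_nonneg _
  set φ : ℝ → ℝ := fun s => ∫ x, ∑ j : Fin 3, ‖fderiv ℝ (u s) x (EuclideanSpace.single j 1)‖ ^ 2 with hφ
  have hφ0 : ∀ s, 0 ≤ φ s := fun s => integral_nonneg fun x => Finset.sum_nonneg fun j _ => sq_nonneg _
  -- the inner integral as the real part of the inner `lintegral`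
  have hinner : ∀ s, ENNReal.ofReal (φ s) ≤ ∫⁻ x, ENNReal.ofReal (frobeniusNormSq (fderiv ℝ (u s) x)) := by
    intro s
    by_cases hI : Integrable (fun x => ∑ j : Fin 3, ‖fderiv ℝ (u s) x (EuclideanSpace.single j 1)‖ ^ 2)
    · rw [hφ]
      dsimp only
      rw [integral_eq_lintegral_of_nonneg_ae (ae_of_all _ fun x => Finset.sum_nonneg fun j _ => sq_nonneg _)
        hI.aestronglyMeasurable]
      refine ENNReal.ofReal_toReal_le.trans (le_of_eq (lintegral_congr fun x => ?_))
      rw [sum_norm_sq_apply_single_eq_frobeniusNormSq]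
    · rw [hφ]
      dsimp only
      rw [integral_undef hI, ENNReal.ofReal_zero]
      exact bot_le
  by_cases hIφ : Integrable φ (volume.restrict (Ioo 0 t))
  · have heq : ∫ s in Ioo 0 t, φ s = (∫⁻ s in Ioo 0 t, ENNReal.ofReal (φ s)).toReal :=
      integral_eq_lintegral_of_nonneg_ae (ae_of_all _ hφ0) hIφ.aestronglyMeasurable
    have hle : ∫⁻ s in Ioo 0 t, ENNReal.ofReal (φ s) ≤ D :=
      calc ∫⁻ s in Ioo 0 t, ENNReal.ofReal (φ s)
          ≤ ∫⁻ s in Ioo 0 t, ∫⁻ x, ENNReal.ofReal (frobeniusNormSq (fderiv ℝ (u s) x)) := lintegral_mono hinner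
        _ ≤ D := lintegral_mono_set (Ioo_subset_Ioo le_rfl ht)
    have hreal : ∫ s in Ioo 0 t, φ s ≤ D.toReal := by
      rw [heq]; exact ENNReal.toReal_mono hfin hle
    calc ν * ∫ s in Ioo 0 t, φ s ≤ ν * D.toReal := mul_le_mul_of_nonneg_left hreal hν.le
      _ ≤ VectorCalculus.kineticEnergy (u 0) := hdiss
  · rw [integral_undef hIφ, mul_zero]
    exact hK0

/-- **The flux ledger along the crux's class.** Let `(u,p)` be a classical solution of unforced
Navier–Stokes on `ℝ³ × [0,T)` (`ν > 0`) that is Leray–Hopf from `u 0`, carrying order-(3,2)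
decay on the closed slab `[0,t]`, `0 < t < T`. Given the weighted energy identity `hWI`
(registered helper of the line), for every `C²` weight `0 ≤ g ≤ 1` of the height with `|g'| ≤ K₁`,
`|g''| ≤ K₂` and all `0 ≤ s₁ ≤ s₂ ≤ t`:
`|∫_{(s₁,s₂)}∫ g'(x₂)(|u|²/2 + (p − π₀(s)))u₂ dx ds| ≤ E₀ (2 + νK₂(s₂ − s₁))`,
`E₀ = kineticEnergy (u 0) = ½‖u(0)‖₂²`. [folklore] -/
theorem fluxLedger_alongLH_of_weightedEnergyIdentity
    (hWI : ∀ (ν : ℝ) (u : EuclideanSpace ℝ (Fin 3) → EuclideanSpace ℝ (Fin 3)) (p : EuclideanSpace ℝ (Fin 3) → ℝ) (C : ℝ), ContDiff ℝ 2 u → ContDiff ℝ 1 p → Literature.Analysis.FluidPDE.VectorCalculus.IsDivFree u → (∀ x, ‖u x‖ ≤ C * (1 + ‖x‖) ^ (-(3 : ℝ))) → (∀ x, ‖fderiv ℝ u x‖ ≤ C * (1 + ‖x‖) ^ (-(3 : ℝ))) → (∀ x, ‖iteratedFDeriv ℝ 2 u x‖ ≤ C * (1 + ‖x‖) ^ (-(3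 : ℝ))) → (∀ x, ‖p x‖ ≤ C * (1 + ‖x‖) ^ (-(2 : ℝ))) → (∀ x, ‖fderiv ℝ p x‖ ≤ C * (1 + ‖x‖) ^ (-(2 : ℝ))) → ∀ (g : ℝ → ℝ) (K : ℝ), ContDiff ℝ 2 g → (∀ z, |g z| ≤ K) → (∀ z, |deriv g z| ≤ K) → (∀ z, |deriv (deriv g) z| ≤ K) → ∫ x, g (x 2) * (2 * inner ℝ (u x) (ν • Laplacian.laplacian u x - Literature.Analysis.FluidPDE.convect u u x - gradient p x)) = ν * (∫ x, deriv (deriv g) (x 2) * ‖u x‖ ^ 2) - 2 * ν * (∫ x, g (x 2) * ∑ j : Fin 3, ‖fderiv ℝ u x (EuclideanSpace.single j 1)‖ ^ 2) + 2 * (∫ x, deriv g (x 2) * ((‖u x‖ ^ 2 / 2 + p x) * u x 2)))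
    (hν : 0 < ν) (hT : 0 < T) (hns : IsClassicalNSSolutionOn (Ico 0 T) ν 0 u p)
    (hlh : IsLerayHopfOn T ν 0 (u 0) u) {t : ℝ} (ht0 : 0 < t) (htT : t < T)
    {C : ℝ} {π₀ : ℝ → ℝ}
    (h0 : ∀ s ∈ Icc 0 t, ∀ x, ‖u s x‖ ≤ C * (1 + ‖x‖) ^ (-(3 : ℝ)))
    (h1 : ∀ s ∈ Icc 0 t, ∀ x, ‖fderiv ℝ (u s) x‖ ≤ C * (1 + ‖x‖) ^ (-(3 : ℝ)))
    (h2 : ∀ s ∈ Icc 0 t, ∀ x, ‖iteratedFDeriv ℝ 2 (u s) x‖ ≤ C * (1 + ‖x‖) ^ (-(3 : ℝ)))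
    (k0 : ∀ s ∈ Icc 0 t, ∀ x, |p s x - π₀ s| ≤ C * (1 + ‖x‖) ^ (-(2 : ℝ)))
    (k1 : ∀ s ∈ Icc 0 t, ∀ x, ‖gradient (p s) x‖ ≤ C * (1 + ‖x‖) ^ (-(2 : ℝ)))
    {g : ℝ → ℝ} (hg : ContDiff ℝ 2 g) {K₁ K₂ : ℝ} (hg01 : ∀ z, 0 ≤ g z ∧ g z ≤ 1)
    (hK₁ : ∀ z, |deriv g z| ≤ K₁) (hK₂ : ∀ z, |deriv (deriv g) z| ≤ K₂)
    {s₁ s₂ : ℝ} (hs₁ : 0 ≤ s₁) (hs : s₁ ≤ s₂) (hs₂ : s₂ ≤ t) :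
    |∫ s in Ioo s₁ s₂, ∫ x, deriv g (x 2) * ((‖u s x‖ ^ 2 / 2 + (p s x - π₀ s)) * u s x 2)| ≤
      VectorCalculus.kineticEnergy (u 0) * (2 + ν * K₂ * (s₂ - s₁)) := by
  have hcl : IsClassicalNSSolutionOn (Icc 0 t) ν 0 u p :=
    hns.mono (Icc_subset_Ico_right htT) (uniqueDiffOn_Icc ht0)
  have hE : ∀ s ∈ Icc 0 t, ∫ x, ‖u s x‖ ^ 2 ≤ 2 * VectorCalculus.kineticEnergy (u 0) := fun s hs' =>
    integral_norm_sq_le_of_isLerayHopfOn hlh hν.le ⟨hs'.1, hs'.2.trans htT.le⟩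
  have hDiss := integral_Ioo_integral_sum_norm_sq_fderiv_le hns hlh hν hT htT.le
  exact fluxLedger_of_weightedEnergyIdentity hWI hν ht0 hcl h0 h1 h2 k0 k1 hE hDiss hg hg01 hK₁ hK₂ hs₁ hs hs₂

/-- **The flux ledger along the crux's class, registered form** (sub-goal
`fluxLedger_alongLH_conditional` of stmt-NavierStokesRegularity-16855). [folklore] -/
theorem fluxLedger_alongLH_conditional : (∀ (ν : ℝ) (u : EuclideanSpace ℝ (Fin 3) → EuclideanSpace ℝ (Fin 3)) (p : EuclideanSpace ℝ (Fin 3) → ℝ) (C : ℝ), ContDiff ℝ 2 u → ContDiff ℝ 1 p → Literature.Analysis.FluidPDE.VectorCalculus.IsDivFree u → (∀ x, ‖u x‖ ≤ C * (1 + ‖x‖) ^ (-(3 : ℝ))) → (∀ x, ‖fderiv ℝ u x‖ ≤ C * (1 + ‖x‖) ^ (-(3 : ℝ))) → (∀ x, ‖iteratedFDeriv ℝ 2 u x‖ ≤ C * (1 + ‖x‖) ^ (-(3 : ℝ))) → (∀ x, ‖p x‖ ≤ C * (1 + ‖x‖) ^ (-(2 : ℝ))) → (∀ x, ‖fderiv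 ℝ p x‖ ≤ C * (1 + ‖x‖) ^ (-(2 : ℝ))) → ∀ (g : ℝ → ℝ) (K : ℝ), ContDiff ℝ 2 g → (∀ z, |g z| ≤ K) → (∀ z, |deriv g z| ≤ K) → (∀ z, |deriv (deriv g) z| ≤ K) → ∫ x, g (x 2) * (2 * inner ℝ (u x) (ν • Laplacian.laplacian u x - Literature.Analysis.FluidPDE.convect u u x - gradient p x)) = ν * (∫ x, deriv (deriv g) (x 2) * ‖u x‖ ^ 2) - 2 * ν * (∫ x, g (x 2) * ∑ j : Fin 3, ‖fderiv ℝ u x (EuclideanSpace.single j 1)‖ ^ 2) + 2 * (∫ x, deriv g (x 2) * ((‖u x‖ ^ 2 / 2 + p x) * u x 2))) → ∀ (ν T : ℝ), 0 < ν → 0 < T → ∀ (u : ℝ → EuclideanSpace ℝ (Fin 3) → EuclideanSpace ℝ (Fin 3)) (p : ℝ → EuclideanSpace ℝ (Fin 3) → ℝ), Literature.Analysis.FluidPDE.IsClassicalNSSolutionOn (Set.Ico 0 T) ν 0 u p → Literature.Analysis.FluidPDE.IsLerayHopfOn T ν 0 (u 0) u → ∀ (t : ℝ), 0 < t → t < T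 → ∀ (C : ℝ) (π₀ : ℝ → ℝ), (∀ s ∈ Set.Icc 0 t, ∀ x, ‖u s x‖ ≤ C * (1 + ‖x‖) ^ (-(3 : ℝ))) → (∀ s ∈ Set.Icc 0 t, ∀ x, ‖fderiv ℝ (u s) x‖ ≤ C * (1 + ‖x‖) ^ (-(3 : ℝ))) → (∀ s ∈ Set.Icc 0 t, ∀ x, ‖iteratedFDeriv ℝ 2 (u s) x‖ ≤ C * (1 + ‖x‖) ^ (-(3 : ℝ))) → (∀ s ∈ Set.Icc 0 t, ∀ x, |p s x - π₀ s| ≤ C * (1 + ‖x‖) ^ (-(2 : ℝ))) → (∀ s ∈ Set.Icc 0 t, ∀ x, ‖gradient (p s) x‖ ≤ C * (1 + ‖x‖) ^ (-(2 : ℝ))) → ∀ (g : ℝ → ℝ) (K₁ K₂ : ℝ), ContDiff ℝ 2 g → (∀ z, 0 ≤ g z ∧ g z ≤ 1) → (∀ z, |deriv g z| ≤ K₁) → (∀ z, |deriv (deriv g) z| ≤ K₂) → ∀ (s₁ s₂ : ℝ), 0 ≤ s₁ → s₁ ≤ s₂ → s₂ ≤ t → |∫ s in Set.Ioo s₁ s₂,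 ∫ x, deriv g (x 2) * ((‖u s x‖ ^ 2 / 2 + (p s x - π₀ s)) * u s x 2)| ≤ Literature.Analysis.FluidPDE.VectorCalculus.kineticEnergy (u 0) * (2 + ν * K₂ * (s₂ - s₁)) :=
  fun hWI _ _ hν hT _ _ hns hlh _ ht0 htT _ _ h0 h1 h2 k0 k1 _ _ _ hg hg01 hK₁ hK₂ _ _ hs₁ hs hs₂ =>
    fluxLedger_alongLH_of_weightedEnergyIdentity hWI hν hT hns hlh ht0 htT h0 h1 h2 k0 k1 hg hg01 hK₁ hK₂ hs₁ hs hs₂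

end Summit.NavierStokesRegularity.NavierStokesRegularity.Theorems.PlanarEnergyAPriori

end
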